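import Literature.NumberTheory.Automorphic.Liu2021.AppendixC.HeckeEndomorphismComplexWord
import Literature.NumberTheory.Automorphic.Liu2021.AppendixC.HeckeEndomorphismSingleTranslate
import Mathlib.GroupTheory.GroupAction.Quotient
import HarnessLib

/-!
# Liu 2021, Appendix C/D glue — the transposed Hecke word with ONE chosen piece per entry (single-piece `fd`)

[cite: Liu2021, p. 133 (before (D.3)): `ℍ_K ⊆ End(A_K)_ℚ` is the image of `C_c^∞(K\G(𝔸_F^∞)/K, ℚ) → End(A_K)_ℚ` induced by the Hecke
actions; §4.2 (FJcycle.tex l. 2070–2074)] [cite: Bump1997, §4.2 (Prop. 4.2.3)] [cite: MumfordAV1970, §19 (Hom(X,Y) first paragraph; Thm. 3)]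
[cite: Lange2023AbelianVarietiesComplex, §4.5.2 (the norm map `N_f`, functorial)] [cite: GortzWedhorn2020, §(3.5) Prop. 3.10 / Ex. 3.11 (p. 73)]

PROOF lane; sequel of ★ `HeckeEndomorphismTransposedWord` ((hx)/(hxd) junction of the d6 `stub_RosH` glue).  There the TRANSPOSED word of
`[KgK]` was recognised brick by brick as `e⁻¹` of a rational combination of `[Kγ⁻¹K] ∈ ℍ_K`, each brick being the FULL fan word of ONE
translate `T_{γ⁻¹} : X_{N″} → X_K` at a refined normal level `N″ = N″_γ` (a sum over ALL pieces `c‴` of `X_{N″} ⊗ L`).  The d6 frame's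
`slot_letters` ((L) pen) builds the transposed entries with ONE CHOSEN piece `c‴ = ch c′` of `X_{N″}` over each piece `c′` of `X_N`, with
the stabiliser weights `w c′ = #Stab_Δ(ch c′)` equalised to `D` by `m c′ = D / w c′` (★ `levelAdjoint_fan_sum_weighted`).  This file
reduces that single-piece word to the full one:

* §1 `card_smul_sum_section_smul_eq_smul_sum` — ORBIT–STABILISER BOOKKEEPING (pure): a finite group `Δ` acting on the pieces `C″` with
  orbits the fibres of `r : C″ → C′`, a section `ch`, a `Δ`-invariant `E : C″ → M` and weights with `m c′ * #Stab(ch c′) = D` give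
  `#Δ • Σ_{c′} m c′ • E (ch c′) = D • Σ_{c‴} E c‴` (no divisibility hypothesis).
* §2 `fan_row_comp_proj`, `perm_fan_comp_proj`, `fan_entry_deck_invariant` — «THE BLOCK IS INDEPENDENT OF THE CHOSEN `c‴`»: the `End(Y_K)`-valued
  entry `E c‴ = πY_K (b″ c‴) ≫ (tt″ c‴ ≫ Nm_{tp″ c‴}) ≫ ιY_K (φ″ c‴)` is invariant under the deck permutations of the pieces, given the
  Y-level deck invariance of the trace word (`Wt″ ≫ W_d = Wt″`, entries extracted by the fan relations), functoriality of `Nm`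
  (★ `Jacobian.pushforward_comp`) and uniqueness of piece maps into a monomorphic piece; `trace_word_comp_deck_eq` derives
  `Wt″ ≫ W_d = Wt″` from the A-level `t″ ≫ Alb T_κ = t″` when the comparison `v″` is right-cancellable.

All model data are HYPOTHESES (as in ★ `HeckeEndomorphismComplexWord`); no definition, no instance, no named fact, no `sorry`.
-/

open CategoryTheory CategoryTheory.Limits AlgebraicGeometry MonoidalCategory CartesianMonoidalCategory NumberField Function MulAction
open Literature.AlgebraicGeometry.Motives

/-! ## §1 Orbit–stabiliser bookkeeping for one representative per fibre -/

namespace Literature.NumberTheory.Automorphic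

/-- **One representative per fibre, weighted by stabilisers, recovers the full sum**: let the finite group `Δ` act on the finite set
`C″` (pieces of `X_{N″} ⊗ L`), let `r : C″ → C′` be `Δ`-invariant with `Δ` transitive on its fibres (pieces over the pieces of `X_N ⊗ L`
along a Galois `q′`), `ch` a section of `r`, `E : C″ → M` a `Δ`-invariant family and `m c′ * #Stab_Δ(ch c′) = D` for all `c′`.  Then
`#Δ • Σ_{c′} m c′ • E (ch c′) = D • Σ_{c‴} E c‴` — by `Σ_{c‴} = Σ_{c′} Σ_{fibre}`, constancy of `E` on fibres = orbits, and
`#orbit · #Stab = #Δ` (Mathlib `card_orbit_mul_card_stabilizer_eq_card_group`). [cite: Bump1997, §4.2 (Prop. 4.2.3: coset counting for double-coset operators)] -/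
theorem card_smul_sum_section_smul_eq_smul_sum {Δ : Type*} [Group Δ] [Fintype Δ] {C'' C' : Type*} [Fintype C''] [DecidableEq C'']
    [Fintype C'] [DecidableEq C'] [MulAction Δ C''] {M : Type*} [AddCommMonoid M]
    (r : C'' → C') (hr : ∀ (d : Δ) (c : C''), r (d • c) = r c) (htrans : ∀ c₁ c₂ : C'', r c₁ = r c₂ → ∃ d : Δ, d • c₁ = c₂)
    (ch : C' → C'') (hch : ∀ c', r (ch c') = c') (E : C'' → M) (hE : ∀ (d : Δ) (c : C''), E (d • c) = E c)
    (m : C' → ℕ) {D : ℕ} (hm : ∀ c', m c' * Fintype.card (stabilizer Δ (ch c')) = D) :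
    Fintype.card Δ • ∑ c', m c' • E (ch c') = D • ∑ c, E c := by
  classical
  -- the fibre of `r` over `c'` is the orbit of `ch c'`
  have hfib : ∀ c', (Finset.univ.filter fun c => r c = c') = (orbit Δ (ch c')).toFinset := fun c' => by
    ext c
    simp only [Finset.mem_filter, Finset.mem_univ, true_and, Set.mem_toFinset, mem_orbit_iff]
    constructor
    · intro h
      exact htrans (ch c') c ((hch c').trans h.symm)
    · rintro ⟨d, rfl⟩
      rw [hr, hch]
  have hconst : ∀ c', ∀ c ∈ (Finset.univ.filter fun c => r c = c'), E c = E (ch c') := fun c' c hc => by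
    obtain ⟨d, rfl⟩ := htrans (ch c') c ((hch c').trans (Finset.mem_filter.mp hc).2.symm)
    exact hE d (ch c')
  have hcard : ∀ c', (Finset.univ.filter fun c => r c = c').card * Fintype.card (stabilizer Δ (ch c')) = Fintype.card Δ := fun c' => by
    rw [hfib, Set.toFinset_card]
    exact card_orbit_mul_card_stabilizer_eq_card_group Δ (ch c')
  calc Fintype.card Δ • ∑ c', m c' • E (ch c')
      = ∑ c', (m c' * Fintype.card Δ) • E (ch c') := by
        rw [Finset.smul_sum]
        exact Finset.sum_congr rfl fun c' _ => by rw [smul_smul, mul_comm]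
    _ = ∑ c', (D * (Finset.univ.filter fun c => r c = c').card) • E (ch c') :=
        Finset.sum_congr rfl fun c' _ => by rw [← hcard c', ← hm c']; congr 1; ring
    _ = D • ∑ c', ∑ c ∈ (Finset.univ.filter fun c => r c = c'), E c := by
        rw [Finset.smul_sum]
        refine Finset.sum_congr rfl fun c' _ => ?_
        rw [Finset.sum_congr rfl (hconst c'), Finset.sum_const, smul_smul]
    _ = D • ∑ c, E c := by rw [Finset.sum_fiberwise Finset.univ r E]

end Literature.NumberTheory.Automorphic

/-! ## §2 The block is independent of the chosen piece: deck invariance of the entries -/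

namespace Literature.NumberTheory.Automorphic.Liu2021.AppendixC

universe u

variable {L : Type u} [Field L]

/-- **Row extraction from a fan matrix**: `(Σ_{c₁} πY_K (b c₁) ≫ tt c₁ ≫ ι″ c₁) ≫ π″ c = πY_K (b c) ≫ tt c` (fan relations `ι″ c ≫ π″ c = 𝟙`,
`ι″ c₁ ≫ π″ c₂ = 0` for `c₁ ≠ c₂`). [cite: MumfordAV1970, §19 (Hom(X,Y), first paragraph)] -/
theorem fan_row_comp_proj {C'' CK : Type*} [Fintype C''] {J'' : C'' → AbelianVariety L} {JK : CK → AbelianVariety L}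
    {Y'' YK : AbelianVariety L} (π'' : ∀ c, Y'' ⟶ J'' c) (ι'' : ∀ c, J'' c ⟶ Y'') (πK : ∀ c, YK ⟶ JK c)
    (hιπ'' : ∀ c, ι'' c ≫ π'' c = 𝟙 (J'' c)) (hιπ''' : ∀ c₁ c₂, c₁ ≠ c₂ → ι'' c₁ ≫ π'' c₂ = 0)
    (b : C'' → CK) (tt : ∀ c, JK (b c) ⟶ J'' c) (c : C'') :
    (∑ c₁, πK (b c₁) ≫ tt c₁ ≫ ι'' c₁) ≫ π'' c = πK (b c) ≫ tt c := by
  rw [Preadditive.sum_comp, Finset.sum_eq_single c (fun c₁ _ hne => ?_) (fun h => absurd (Finset.mem_univ c) h)]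
  · simp only [Category.assoc]
    rw [hιπ'' c, Category.comp_id]
  · simp only [Category.assoc]
    rw [hιπ''' c₁ c hne, comp_zero, comp_zero]

/-- **Row extraction from a permutation fan matrix**: for an injective index map `σ` and entries `g c₁ : J″ c₁ → J″ (σ c₁)`,
`(Σ_{c₁} π″ c₁ ≫ g c₁ ≫ ι″ (σ c₁)) ≫ π″ (σ c) = π″ c ≫ g c`. [cite: MumfordAV1970, §19 (Hom(X,Y), first paragraph)] -/
theorem perm_fan_comp_proj {C'' : Type*} [Fintype C''] {J'' : C'' → AbelianVariety L} {Y'' : AbelianVariety L}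
    (π'' : ∀ c, Y'' ⟶ J'' c) (ι'' : ∀ c, J'' c ⟶ Y'')
    (hιπ'' : ∀ c, ι'' c ≫ π'' c = 𝟙 (J'' c)) (hιπ''' : ∀ c₁ c₂, c₁ ≠ c₂ → ι'' c₁ ≫ π'' c₂ = 0)
    (σ : C'' → C'') (hσ : Function.Injective σ) (g : ∀ c₁, J'' c₁ ⟶ J'' (σ c₁)) (c : C'') :
    (∑ c₁, π'' c₁ ≫ g c₁ ≫ ι'' (σ c₁)) ≫ π'' (σ c) = π'' c ≫ g c := by
  rw [Preadditive.sum_comp, Finset.sum_eq_single c (fun c₁ _ hne => ?_) (fun h => absurd (Finset.mem_univ c) h)]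
  · simp only [Category.assoc]
    rw [hιπ'' (σ c), Category.comp_id]
  · simp only [Category.assoc]
    rw [hιπ''' (σ c₁) (σ c) (fun h => hne (hσ h)), comp_zero, comp_zero]

/-- **Norm maps into a monomorphic piece depend only on the ambient composite**: two piece maps `p₁ : E → E_K c₁`, `p₂ : E → E_K c₂` over
the same ambient map (`p₁ ≫ e_K c₁ = p₂ ≫ e_K c₂`, `c₁ = c₂`, `e_K` monomorphisms) have the same `Nm ≫ ιY_K` (transport along `c₁ = c₂`,
then `cancel_mono`). [cite: Lange2023AbelianVarietiesComplex, §4.5.2 (the norm map N_f)] [cite: GortzWedhorn2020, §(3.5) Proposition 3.10 and Example 3.11 (p. 73)] -/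
theorem pushforward_comp_inj_eq_of_index_eq {CK : Type*} {XK : SchemeOver L} {EK : CK → SchemeOver L} (eK : ∀ c, EK c ⟶ XK)
    [∀ c, Mono (eK c)] (JK : ∀ c, Jacobian (EK c)) {YK : AbelianVariety L} (ιK : ∀ c, (JK c).J ⟶ YK)
    {E : SchemeOver L} (J : Jacobian E) {c₁ c₂ : CK} (h : c₁ = c₂) (p₁ : E ⟶ EK c₁) (p₂ : E ⟶ EK c₂)
    (hp : p₁ ≫ eK c₁ = p₂ ≫ eK c₂) : J.pushforward (JK c₁) p₁ ≫ ιK c₁ = J.pushforward (JK c₂) p₂ ≫ ιK c₂ := by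
  subst h
  rw [cancel_mono] at hp
  rw [hp]

section Deck

variable {XN'' XK : SchemeOver L}
  -- pieces of `X_{N″} ⊗ L` with their Jacobians and the fan of `Y″`
  {C'' : Type} [Fintype C''] (E'' : C'' → SchemeOver L) (e'' : ∀ c, E'' c ⟶ XN'') (J'' : ∀ c, Jacobian (E'' c))
  (Y'' : AbelianVariety L) (π'' : ∀ c, Y'' ⟶ (J'' c).J) (ι'' : ∀ c, (J'' c).J ⟶ Y'')
  -- pieces of `X_K ⊗ L` (monomorphic), their Jacobians and the fan of `Y_K`
  {CK : Type} (EK : CK → SchemeOver L) (eK : ∀ c, EK c ⟶ XK) (JK : ∀ c, Jacobian (EK c))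
  (YK : AbelianVariety L) (πK : ∀ c, YK ⟶ (JK c).J) (ιK : ∀ c, (JK c).J ⟶ YK)
  -- deck transformations: a group `Δ` permuting the pieces, ambient automorphisms `Tκ d` and piece isomorphisms `dk d c`
  {Δ : Type*} [Group Δ] [MulAction Δ C''] (Tκ : Δ → (XN'' ⟶ XN'')) (dk : ∀ (d : Δ) (c : C''), E'' c ⟶ E'' (d • c))
  -- the translate `T : X_{N″} → X_K` with its piece maps, and the trace word in matrix form
  (T : XN'' ⟶ XK) (φ'' : C'' → CK) (tp'' : ∀ c, E'' c ⟶ EK (φ'' c)) (b'' : C'' → CK) (tt'' : ∀ c, (JK (b'' c)).J ⟶ (J'' c).J)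

/-- **THE BLOCK IS INDEPENDENT OF THE CHOSEN PIECE** (deck invariance of the transposed entries).  Let `Δ` act on the pieces `c‴` of
`X_{N″} ⊗ L` through ambient automorphisms `T_κ(d)` with piece isomorphisms `dk d c‴ : E″ c‴ → E″ (d • c‴)` over them, let
`T : X_{N″} ⊗ L → X_K ⊗ L` be `Δ`-invariant (`T_κ(d) ≫ T = T` — the deck group of `q′` fixes `T_{γ⁻¹}^{N″→K} = q′ ≫ u`) with piece maps
`tp″ c‴ : E″ c‴ → E_K (φ″ c‴)` (`φ″` `Δ`-invariant), and let the trace word `Wt″ = Σ πY_K (b″ c‴) ≫ tt″ c‴ ≫ ι″ c‴` be deck invariant at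
the Y-level: `Wt″ ≫ W_d = Wt″`, `W_d = Σ π″ c‴ ≫ Nm_{dk d c‴} ≫ ι″ (d • c‴)`.  Then the `End(Y_K)`-valued entry
`E c‴ := πY_K (b″ c‴) ≫ (tt″ c‴ ≫ Nm_{tp″ c‴}) ≫ ιY_K (φ″ c‴)` satisfies `E (d • c‴) = E c‴`: the entries over one piece `c′` of `X_N`
(one `Δ`-orbit) all agree, so the (L) pen may pick any representative `ch c′`.  Proof: row extraction gives
`πY_K (b″ (d•c‴)) ≫ tt″ (d•c‴) = πY_K (b″ c‴) ≫ tt″ c‴ ≫ Nm_{dk}`; `Nm_{dk} ≫ Nm_{tp″ (d•c‴)} = Nm_{dk ≫ tp″ (d•c‴)}` (★ `pushforward_comp`);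
`dk ≫ tp″ (d • c‴)` and `tp″ c‴` lie over the same ambient map `e″ c‴ ≫ T`, so their norm maps into `Y_K` agree.
[cite: Liu2021, §4.2 (FJcycle.tex l. 2070–2074)] [cite: Lange2023AbelianVarietiesComplex, §4.5.2 (the norm map N_f)]
[cite: GortzWedhorn2020, §(3.5) Proposition 3.10 and Example 3.11 (p. 73)] [cite: MumfordAV1970, §19 (Hom(X,Y), first paragraph)] -/
theorem fan_entry_deck_invariant [∀ c, Mono (eK c)]
    (hιπ'' : ∀ c, ι'' c ≫ π'' c = 𝟙 (J'' c).J) (hιπ''' : ∀ c₁ c₂, c₁ ≠ c₂ → ι'' c₁ ≫ π'' c₂ = 0)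
    (hdk : ∀ (d : Δ) (c : C''), dk d c ≫ e'' (d • c) = e'' c ≫ Tκ d) (hκ : ∀ d : Δ, Tκ d ≫ T = T)
    (htp'' : ∀ c, tp'' c ≫ eK (φ'' c) = e'' c ≫ T) (hφ : ∀ (d : Δ) (c : C''), φ'' (d • c) = φ'' c)
    (hWd : ∀ d : Δ, (∑ c, πK (b'' c) ≫ tt'' c ≫ ι'' c) ≫ (∑ c, π'' c ≫ (J'' c).pushforward (J'' (d • c)) (dk d c) ≫ ι'' (d • c)) =
      ∑ c, πK (b'' c) ≫ tt'' c ≫ ι'' c)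
    (d : Δ) (c : C'') :
    πK (b'' (d • c)) ≫ (tt'' (d • c) ≫ (J'' (d • c)).pushforward (JK (φ'' (d • c))) (tp'' (d • c))) ≫ ιK (φ'' (d • c)) =
      πK (b'' c) ≫ (tt'' c ≫ (J'' c).pushforward (JK (φ'' c)) (tp'' c)) ≫ ιK (φ'' c) := by
  -- (a) row extraction from the deck invariance of the trace word
  have hrow : πK (b'' (d • c)) ≫ tt'' (d • c) = πK (b'' c) ≫ tt'' c ≫ (J'' c).pushforward (J'' (d • c)) (dk d c) := by
    have h : ((∑ c, πK (b'' c) ≫ tt'' c ≫ ι'' c) ≫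
        ∑ c, π'' c ≫ (J'' c).pushforward (J'' (d • c)) (dk d c) ≫ ι'' (d • c)) ≫ π'' (d • c) =
        (∑ c, πK (b'' c) ≫ tt'' c ≫ ι'' c) ≫ π'' (d • c) := by rw [hWd d]
    rw [fan_row_comp_proj π'' ι'' πK hιπ'' hιπ''' b'' tt'' (d • c), Category.assoc,
      perm_fan_comp_proj π'' ι'' hιπ'' hιπ''' (fun c => d • c) (MulAction.injective d)
        (fun c₁ => (J'' c₁).pushforward (J'' (d • c₁)) (dk d c₁)) c,
      ← Category.assoc, fan_row_comp_proj π'' ι'' πK hιπ'' hιπ''' b'' tt'' c, Category.assoc] at h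
    exact h.symm
  -- (b) the two piece maps into `X_K` lie over the same ambient map
  have hamb : (dk d c ≫ tp'' (d • c)) ≫ eK (φ'' (d • c)) = tp'' c ≫ eK (φ'' c) := by
    rw [Category.assoc, htp'', ← Category.assoc, hdk, Category.assoc, hκ, htp'']
  have hnm := pushforward_comp_inj_eq_of_index_eq eK JK ιK (J'' c) (hφ d c) _ _ hamb
  rw [Jacobian.pushforward_comp] at hnm
  simp only [Category.assoc] at hnm ⊢
  rw [← Category.assoc (πK (b'' (d • c))), hrow]
  simp only [Category.assoc]
  rw [hnm]

end Deck

end Literature.NumberTheory.Automorphic.Liu2021.AppendixC
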